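import Literature.MathematicalPhysics.KineticTheory.LangevinChainCostate

/-!
# Energy window, part W-7a — costate calculus on an initial time window `[0, t]`

Lineage `stmt-AtomisticToContinuum-9121` (`ExtensiveSnapshotIrreversibility`), K_fix half, leaf S3;
cell decomp-a2c, lens «grading / quantitative ladder», generation 81, part W «Glues», file 7a.
PURPOSE.  The proof of the leaf (I-s2)ₛ `SkeletonEventualSurjectivity` (W-0; proved in W-7b) is the
port to the time window `[0, s]`, `0 < s ≤ 1`, of the tree's `s = 1` argument
(`Literature…LangevinChainKernelDensity.exists_forall_range_fderiv_skelFlowMap_eq_top`).  That argument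
rests on four time-`1` costate lemmas of `Literature…LangevinChainCostate` (`dualPair_costate_one`,
`dualPair_costate_one_momentum`, `integral_deriv_mul_rtent`, `dualPair_costate_one_tent`,
`eqOn_zero_of_dyadic_integral_eq_zero`, `costate_one_eq_zero_of_dyadic`), whose statements hard-wire
the endpoint `1` and ALL dyadic cells of `[0, 1]`.  This file proves their time-`t` versions, for an
arbitrary endpoint `t` and the dyadic cells `[k/2^m, (k+1)/2^m]` INSIDE `[0, t]` only:
* §1 `dualPair_costate_at` — the costate representation `⟨c(t), w(t)⟩ = ⟨c(t), φ(t)⟩ + ∫₀ᵗ ⟨c, DY(ζ) φ⟩`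
  for a solution `w = φ + ∫₀ DY(ζ) w` of the variational integral equation and a costate
  `ċ = G(ζ) c` on `(0, t)`, continuous on `[0, t]` (differentiate `⟨c, w − φ⟩`; adjoint identity);
  `dualPair_costate_at_momentum` — pure momentum forcing `φ = (0, h)`;
* §2 `integral_deriv_mul_rtent_of_le` — integration by parts against the dyadic tent `θ^m_k` for a cell
  with right end `≤ t`: `∫₀ᵗ f' θ^m_k = f(t) − 2^m ∫_{cell} f`; `dualPair_costate_at_tent` — for the tent
  forcing at momentum `i₀` with amplitude `a`, `⟨c(t), w(t)⟩ = a 2^m ∫_{cell} (c ·).2 i₀`;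
* §3 `eqOn_zero_of_dyadic_integral_eq_zero_of_le` — a function continuous on `[0, t]` whose means over
  all dyadic cells inside `[0, t]` vanish is zero on `[0, t]` (a direct positivity argument at an
  interior point: continuity gives a sign on a small dyadic cell around it, `intervalIntegral_pos_of_pos_on`;
  then closure) — this replaces the tree's primitive-at-dyadic-nodes argument, which needs every node of
  `[0, 1]`; `costate_at_eq_zero_of_dyadic` — vanishing dyadic means of the left-bath momentum component of a
  costate on the cells inside `[0, t]` force `c(t) = 0` (tree `costate_eq_zero_of_snd_left` on `J = (0, t)`,
  the linearised observability of the chain through its left end, `V'' ≠ 0`).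
All statements are over the tree's `dualPair`, `OscillatorChain.coDrift`, `rnode`, `rtent`; nothing new is
defined.  No instance / notation / option; no proof holes.  References: the tree file above (CEHR
Prop. 4.1 for the observability step) [cite: CuneoEckmannHairerReyBellet2018, Prop 4.1]. [folklore]
-/

noncomputable section

namespace Summit.AtomisticToContinuum.FouriersLaw.Theorems.ExtensiveSnapshotIrreversibility.EnergyWindow

open MeasureTheory Filter Topology Set
open scoped ContDiff
open Literature.MathematicalPhysics.KineticTheory.HeatConduction

variable {P : OscillatorChain} {N : ℕ}

/-! ## 1. The costate representation of `⟨c(t), w(t)⟩` -/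

/-- **Costate representation at time `t`.** Let `w` solve `w(τ) = φ(τ) + ∫₀^τ DY(ζ(s)) w(s) ds` on
`[0, t]` along a continuous curve `ζ`, and let `c` be a costate (`ċ = G(ζ) c` on `(0, t)`, continuous on
`[0, t]`).  Then `⟨c(t), w(t)⟩ = ⟨c(t), φ(t)⟩ + ∫₀ᵗ ⟨c(s), DY(ζ(s)) φ(s)⟩ ds` (the tree's
`dualPair_costate_one` is `t = 1`; same proof). [folklore] -/
theorem dualPair_costate_at (hU : ContDiff ℝ ∞ P.U) (hV : ContDiff ℝ ∞ P.V) {t : ℝ} (ht : 0 ≤ t)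
    {ζ c w φ : ℝ → PhaseSpace N} (hζ : Continuous ζ) (hw : Continuous w) (hφ : Continuous φ)
    (hcc : ContinuousOn c (Icc 0 t))
    (hc : ∀ s ∈ Ioo (0 : ℝ) t, HasDerivAt c (P.coDrift N (ζ s) (c s)) s)
    (hwint : ∀ τ ∈ Icc (0 : ℝ) t,
      w τ = φ τ + ∫ s in (0 : ℝ)..τ, fderiv ℝ (P.drift N) (ζ s) (w s)) :
    dualPair (c t) (w t) =
      dualPair (c t) (φ t) +
        ∫ s in (0 : ℝ)..t, dualPair (c s) (fderiv ℝ (P.drift N) (ζ s) (φ s)) := by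
  set A : ℝ → PhaseSpace N →L[ℝ] PhaseSpace N := fun s => fderiv ℝ (P.drift N) (ζ s) with hA
  have hAc : Continuous A := P.continuous_fderiv_drift_comp hU hV N hζ
  have hg : Continuous fun s => A s (w s) := hAc.clm_apply hw
  set u : ℝ → PhaseSpace N := fun τ => ∫ s in (0 : ℝ)..τ, A s (w s) with hu
  have hud : ∀ τ, HasDerivAt u (A τ (w τ)) τ := fun τ =>
    (hg.integral_hasStrictDerivAt 0 τ).hasDerivAt
  have huc : Continuous u := continuous_iff_continuousAt.2 fun τ => (hud τ).continuousAt
  have hwu : ∀ τ ∈ Icc (0 : ℝ) t, w τ - u τ = φ τ := fun τ hτ => by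
    rw [hwint τ hτ, hu]
    exact add_sub_cancel_right _ _
  -- `F(s) = ⟨c s, u s⟩` has derivative `⟨c s, A s (φ s)⟩` on `(0, t)`
  set F : ℝ → ℝ := fun s => dualPair (c s) (u s) with hF
  set F' : ℝ → ℝ := fun s => dualPair (c s) (A s (φ s)) with hF'
  have hFd : ∀ s ∈ Ioo (0 : ℝ) t, HasDerivWithinAt F (F' s) (Ioi s) s := by
    intro s hs
    have h := hasDerivAt_dualPair (hc s hs) (hud s)
    have hval : dualPair (P.coDrift N (ζ s) (c s)) (u s) + dualPair (c s) (A s (w s)) = F' s := by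
      rw [P.dualPair_coDrift hU hV, hF']
      change -dualPair (c s) (A s (u s)) + dualPair (c s) (A s (w s)) = dualPair (c s) (A s (φ s))
      rw [← hwu s (Ioo_subset_Icc_self hs), map_sub, dualPair_sub_right]
      ring
    rw [hval] at h
    exact h.hasDerivWithinAt
  have hFc : ContinuousOn F (Icc 0 t) :=
    continuous_dualPair.comp_continuousOn (hcc.prodMk huc.continuousOn)
  have hF'c : ContinuousOn F' (Icc 0 t) :=
    continuous_dualPair.comp_continuousOn (hcc.prodMk ((hAc.clm_apply hφ).continuousOn))
  have hint : IntervalIntegrable F' volume 0 t :=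
    (hF'c.mono (by rw [Set.uIcc_of_le ht])).intervalIntegrable
  have hFTC := intervalIntegral.integral_eq_sub_of_hasDeriv_right_of_le ht hFc hFd hint
  -- evaluate `F t` and `F 0`
  have hF0 : F 0 = 0 := by simp [hF, hu, dualPair]
  have hF1 : F t = dualPair (c t) (w t) - dualPair (c t) (φ t) := by
    rw [hF]
    change dualPair (c t) (u t) = _
    rw [← hwu t (right_mem_Icc.2 ht), dualPair_sub_right]
    ring
  rw [hF0, hF1, sub_zero] at hFTC
  linarith

/-- **Costate representation at time `t` for momentum forcing** `φ(s) = (0, h(s))`: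
`⟨c(t), w(t)⟩ = ∑_i β_i(t) h_i(t) − ∫₀ᵗ ∑_i β̇_i(s) h_i(s) ds`, `β = c.2`, `β̇ = (G(ζ)c).2` (tree
`dualPair_costate_one_momentum` is `t = 1`). [folklore] -/
theorem dualPair_costate_at_momentum (hU : ContDiff ℝ ∞ P.U) (hV : ContDiff ℝ ∞ P.V) {t : ℝ}
    (ht : 0 ≤ t) {ζ c w : ℝ → PhaseSpace N} {h : ℝ → Fin N → ℝ} (hζ : Continuous ζ)
    (hw : Continuous w) (hh : Continuous h) (hcc : ContinuousOn c (Icc 0 t))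
    (hc : ∀ s ∈ Ioo (0 : ℝ) t, HasDerivAt c (P.coDrift N (ζ s) (c s)) s)
    (hwint : ∀ τ ∈ Icc (0 : ℝ) t,
      w τ = ((0 : Fin N → ℝ), h τ) + ∫ s in (0 : ℝ)..τ, fderiv ℝ (P.drift N) (ζ s) (w s)) :
    dualPair (c t) (w t) =
      ∑ i, (c t).2 i * h t i - ∫ s in (0 : ℝ)..t, ∑ i, (P.coDrift N (ζ s) (c s)).2 i * h s i := by
  have hφ : Continuous fun s => (((0 : Fin N → ℝ), h s) : PhaseSpace N) := continuous_const.prodMk hh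
  rw [dualPair_costate_at hU hV ht hζ hw hφ hcc hc hwint, dualPair_zero_mk]
  simp_rw [P.dualPair_fderiv_drift_zero_mk hU hV]
  rw [intervalIntegral.integral_neg, sub_eq_add_neg]

/-! ## 2. Integration by parts against a dyadic tent supported before `t` -/

/-- **Integration by parts against a dyadic tent, on `[0, t]`.** For `f` continuous on `[0, t]` with
a derivative `f'` on `(0, t)` that extends continuously to `[0, t]`, and a dyadic cell
`[t^m_k, t^m_{k+1}]` with `t^m_{k+1} ≤ t`: `∫₀ᵗ f'(s) θ^m_k(s) ds = f(t) − 2^m ∫_{t^m_k}^{t^m_{k+1}} f(s) ds`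
(the tent is `0` before the cell, linear on it, `1` after it; tree `integral_deriv_mul_rtent` is
`t = 1`). [folklore] -/
theorem integral_deriv_mul_rtent_of_le {f f' : ℝ → ℝ} {t : ℝ} (hfc : ContinuousOn f (Icc 0 t))
    (hf'c : ContinuousOn f' (Icc 0 t)) (hf : ∀ s ∈ Ioo (0 : ℝ) t, HasDerivAt f (f' s) s)
    {m k : ℕ} (hkt : rnode m (k + 1) ≤ t) :
    ∫ s in (0 : ℝ)..t, f' s * rtent m k s =
      f t - 2 ^ m * ∫ s in rnode m k..rnode m (k + 1), f s := by
  set a := rnode m k with ha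
  set b := rnode m (k + 1) with hb
  have ha0 : 0 ≤ a := rnode_nonneg m k
  have hab : a ≤ b := rnode_le_succ m k
  have hb0 : 0 < b := rnode_succ_pos m k
  have hb1 : b ≤ t := hkt
  have ha1 : a ≤ t := hab.trans hb1
  have ht0 : 0 ≤ t := hb0.le.trans hb1
  have hprod : ContinuousOn (fun s => f' s * rtent m k s) (Icc 0 t) :=
    hf'c.mul (continuous_rtent m k).continuousOn
  have hii : ∀ x y : ℝ, x ∈ Icc (0 : ℝ) t → y ∈ Icc (0 : ℝ) t →
      IntervalIntegrable (fun s => f' s * rtent m k s) volume x y := fun x y hx hy =>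
    (hprod.mono (uIcc_subset_Icc hx hy)).intervalIntegrable
  have hiif' : ∀ x y : ℝ, x ∈ Icc (0 : ℝ) t → y ∈ Icc (0 : ℝ) t →
      IntervalIntegrable f' volume x y := fun x y hx hy =>
    (hf'c.mono (uIcc_subset_Icc hx hy)).intervalIntegrable
  have hmem0 : (0 : ℝ) ∈ Icc (0 : ℝ) t := ⟨le_rfl, ht0⟩
  have hmemt : t ∈ Icc (0 : ℝ) t := ⟨ht0, le_rfl⟩
  have hmema : a ∈ Icc (0 : ℝ) t := ⟨ha0, ha1⟩
  have hmemb : b ∈ Icc (0 : ℝ) t := ⟨hb0.le, hb1⟩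
  -- split the integral at `a` and `b`
  rw [← intervalIntegral.integral_add_adjacent_intervals (hii 0 a hmem0 hmema) (hii a t hmema hmemt),
    ← intervalIntegral.integral_add_adjacent_intervals (hii a b hmema hmemb) (hii b t hmemb hmemt)]
  -- `[0, a]`: the tent vanishes
  have h1 : ∫ s in (0 : ℝ)..a, f' s * rtent m k s = 0 := by
    rw [intervalIntegral.integral_congr (g := fun _ => (0 : ℝ)) fun s hs => ?_]
    · simp
    · rw [uIcc_of_le ha0] at hs
      simp [rtent_of_le hs.2]
  -- `[b, t]`: the tent is `1`
  have h3 : ∫ s in b..t, f' s * rtent m k s = f t - f b := by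
    rw [intervalIntegral.integral_congr (g := f') fun s hs => ?_]
    · exact intervalIntegral.integral_eq_sub_of_hasDeriv_right_of_le hb1
        (hfc.mono (Icc_subset_Icc hb0.le le_rfl))
        (fun s hs => (hf s ⟨hb0.trans hs.1, hs.2⟩).hasDerivWithinAt) (hiif' b t hmemb hmemt)
    · rw [uIcc_of_le hb1] at hs
      simp [rtent_of_ge hs.1]
  -- `[a, b]`: fundamental theorem for `f(s) 2^m (s - a)`
  have h2 : ∫ s in a..b, f' s * rtent m k s = f b - 2 ^ m * ∫ s in a..b, f s := by
    have hlinc : Continuous fun s : ℝ => (2 : ℝ) ^ m * (s - a) := by fun_prop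
    have hG : ∫ s in a..b, (f' s * (2 ^ m * (s - a)) + f s * 2 ^ m) =
        f b * (2 ^ m * (b - a)) - f a * (2 ^ m * (a - a)) := by
      refine intervalIntegral.integral_eq_sub_of_hasDeriv_right_of_le hab
        ((hfc.mono (Icc_subset_Icc ha0 hb1)).mul hlinc.continuousOn) (fun s hs => ?_) ?_
      · have hs' : s ∈ Ioo (0 : ℝ) t := ⟨ha0.trans_lt hs.1, hs.2.trans_le hb1⟩
        have hlin : HasDerivAt (fun s : ℝ => 2 ^ m * (s - a)) (2 ^ m) s := by
          simpa using ((hasDerivAt_id s).sub_const a).const_mul (2 ^ m : ℝ)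
        exact ((hf s hs').mul hlin).hasDerivWithinAt
      · exact ((hf'c.mul hlinc.continuousOn).add (hfc.mul continuousOn_const)).mono
          (uIcc_subset_Icc hmema hmemb) |>.intervalIntegrable
    have hI1 : IntervalIntegrable (fun s => f' s * (2 ^ m * (s - a))) volume a b :=
      ((hf'c.mul hlinc.continuousOn).mono (uIcc_subset_Icc hmema hmemb)).intervalIntegrable
    have hI2 : IntervalIntegrable (fun s => f s * 2 ^ m) volume a b :=
      ((hfc.mul continuousOn_const).mono (uIcc_subset_Icc hmema hmemb)).intervalIntegrable
    have hsplit : ∫ s in a..b, (f' s * (2 ^ m * (s - a)) + f s * 2 ^ m) =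
        (∫ s in a..b, f' s * (2 ^ m * (s - a))) + ∫ s in a..b, f s * 2 ^ m :=
      intervalIntegral.integral_add hI1 hI2
    rw [sub_self, mul_zero, mul_zero, sub_zero, show b - a = 1 / 2 ^ m from rnode_succ_sub m k,
      hsplit, intervalIntegral.integral_mul_const] at hG
    have hcongr : ∫ s in a..b, f' s * rtent m k s = ∫ s in a..b, f' s * (2 ^ m * (s - a)) :=
      intervalIntegral.integral_congr fun s hs => by
        rw [uIcc_of_le hab] at hs
        simp only [rtent_of_mem hs, ha]
    rw [hcongr]
    have h2m : (2 : ℝ) ^ m * (1 / 2 ^ m) = 1 := by field_simp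
    rw [h2m, mul_one] at hG
    linarith
  rw [h1, h2, h3]
  ring

/-- **Costate representation for a dyadic tent forcing at one momentum coordinate, at time `t`**:
if `w(τ) = (0, a θ^m_k(τ) e_{i₀}) + ∫₀^τ DY(ζ) w` on `[0, t]` and the cell `[t^m_k, t^m_{k+1}]` lies
in `[0, t]`, then `⟨c(t), w(t)⟩ = a 2^m ∫_{t^m_k}^{t^m_{k+1}} β_{i₀}(s) ds`, `β_{i₀} = (c ·).2 i₀` (the
boundary term `a β_{i₀}(t) θ^m_k(t) = a β_{i₀}(t)` cancels against the one of §2; tree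
`dualPair_costate_one_tent` is `t = 1`). [folklore] -/
theorem dualPair_costate_at_tent (hU : ContDiff ℝ ∞ P.U) (hV : ContDiff ℝ ∞ P.V) {t : ℝ}
    {ζ c w : ℝ → PhaseSpace N} (hζ : Continuous ζ) (hw : Continuous w)
    (hcc : ContinuousOn c (Icc 0 t))
    (hc : ∀ s ∈ Ioo (0 : ℝ) t, HasDerivAt c (P.coDrift N (ζ s) (c s)) s) (i₀ : Fin N) (a : ℝ)
    {m k : ℕ} (hkt : rnode m (k + 1) ≤ t)
    (hwint : ∀ τ ∈ Icc (0 : ℝ) t,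
      w τ = ((0 : Fin N → ℝ), fun i => if i = i₀ then a * rtent m k τ else 0) +
        ∫ s in (0 : ℝ)..τ, fderiv ℝ (P.drift N) (ζ s) (w s)) :
    dualPair (c t) (w t) = a * 2 ^ m * ∫ s in rnode m k..rnode m (k + 1), (c s).2 i₀ := by
  have ht : 0 ≤ t := (rnode_succ_pos m k).le.trans hkt
  have hh : Continuous fun τ : ℝ => fun i : Fin N => if i = i₀ then a * rtent m k τ else 0 := by
    refine continuous_pi fun i => ?_
    split_ifs <;> fun_prop
  rw [dualPair_costate_at_momentum hU hV ht hζ hw hh hcc hc hwint]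
  simp only [mul_ite, mul_zero, Finset.sum_ite_eq', Finset.mem_univ, if_true, rtent_of_ge hkt,
    mul_one]
  -- the integration by parts
  set f : ℝ → ℝ := fun s => (c s).2 i₀ with hf
  set f' : ℝ → ℝ := fun s => (P.coDrift N (ζ s) (c s)).2 i₀ with hf'
  have hfc : ContinuousOn f (Icc 0 t) :=
    ((continuous_apply i₀).comp continuous_snd).comp_continuousOn hcc
  have hf'c : ContinuousOn f' (Icc 0 t) := by
    have h1 : ContinuousOn (fun s => (c s).1 i₀) (Icc 0 t) :=
      ((continuous_apply i₀).comp continuous_fst).comp_continuousOn hcc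
    simp only [hf', OscillatorChain.coDrift_snd]
    exact h1.neg.add (continuousOn_const.mul hfc)
  have hfd : ∀ s ∈ Ioo (0 : ℝ) t, HasDerivAt f (f' s) s := fun s hs =>
    (hasDerivAt_pi.1 (hc s hs).snd) i₀
  have hibp := integral_deriv_mul_rtent_of_le hfc hf'c hfd hkt
  have hint : ∫ s in (0 : ℝ)..t, (P.coDrift N (ζ s) (c s)).2 i₀ * (a * rtent m k s) =
      a * ∫ s in (0 : ℝ)..t, f' s * rtent m k s := by
    rw [← intervalIntegral.integral_const_mul]
    exact intervalIntegral.integral_congr fun s _ => by simp only [hf']; ring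
  rw [hint, hibp]
  simp only [hf]
  ring

/-! ## 3. Vanishing dyadic means on the cells inside `[0, t]` -/

/-- **Vanishing dyadic means force a continuous function to vanish (cells inside `[0, t]`).** If `f`
is continuous on `[0, t]`, `t > 0`, and `∫_{t^m_k}^{t^m_{k+1}} f = 0` for every dyadic cell with
`t^m_{k+1} ≤ t`, then `f = 0` on `[0, t]`.  (At an interior point `s` with `f(s) ≠ 0`, continuity gives
`|f − f(s)| < |f(s)|/2` on a neighbourhood inside `(0, t)`; a dyadic cell of small mesh containing `s`
lies in it, and the integral of `f` over that cell has the sign of `f(s)`, a contradiction; closure.)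
[folklore] -/
theorem eqOn_zero_of_dyadic_integral_eq_zero_of_le {f : ℝ → ℝ} {t : ℝ} (ht : 0 < t)
    (hf : ContinuousOn f (Icc 0 t))
    (h : ∀ m k : ℕ, rnode m (k + 1) ≤ t → ∫ s in rnode m k..rnode m (k + 1), f s = 0) :
    ∀ s ∈ Icc (0 : ℝ) t, f s = 0 := by
  -- interior points
  have hIoo : ∀ s ∈ Ioo (0 : ℝ) t, f s = 0 := by
    intro s hs
    by_contra hne
    have habs : 0 < |f s| / 2 := half_pos (abs_pos.2 hne)
    have hcont : ContinuousAt f s := hf.continuousAt (Icc_mem_nhds hs.1 hs.2)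
    obtain ⟨η, hη, hηf⟩ := Metric.continuousAt_iff.1 hcont (|f s| / 2) habs
    set η' : ℝ := min η (min s (t - s)) with hη'
    have hη'0 : 0 < η' := lt_min hη (lt_min hs.1 (sub_pos.2 hs.2))
    have hη'η : η' ≤ η := min_le_left _ _
    have hη's : η' ≤ s := (min_le_right _ _).trans (min_le_left _ _)
    have hη't : η' ≤ t - s := (min_le_right _ _).trans (min_le_right _ _)
    obtain ⟨m, hm⟩ := exists_pow_lt_of_lt_one (half_pos hη'0) (by norm_num : (1 / 2 : ℝ) < 1)
    have h2m : (0 : ℝ) < 2 ^ m := by positivity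
    have hpow : (1 / 2 : ℝ) ^ m = 1 / 2 ^ m := by rw [one_div_pow]
    rw [hpow] at hm
    set k : ℕ := ⌊s * 2 ^ m⌋₊ with hk
    have hk1 : (k : ℝ) ≤ s * 2 ^ m := Nat.floor_le (mul_nonneg hs.1.le h2m.le)
    have hk2 : s * 2 ^ m < k + 1 := Nat.lt_floor_add_one _
    have hak : rnode m k ≤ s := by
      show (k : ℝ) / 2 ^ m ≤ s
      rw [div_le_iff₀ h2m]
      exact hk1
    have hbk : s < rnode m (k + 1) := by
      show s < ((k + 1 : ℕ) : ℝ) / 2 ^ m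
      rw [lt_div_iff₀ h2m]
      push_cast
      exact hk2
    have hlen : rnode m (k + 1) - rnode m k = 1 / 2 ^ m := rnode_succ_sub m k
    have hlo : s - η' < rnode m k := by linarith
    have hhi : rnode m (k + 1) < s + η' := by linarith
    have hkt : rnode m (k + 1) ≤ t := by linarith
    have hk0 : 0 ≤ rnode m k := rnode_nonneg m k
    have hab : rnode m k < rnode m (k + 1) := hak.trans_lt hbk
    -- on the cell, `|f u - f s| < |f s| / 2`
    have hnear : ∀ u ∈ Icc (rnode m k) (rnode m (k + 1)), |f u - f s| < |f s| / 2 := by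
      intro u hu
      have hd : dist u s < η := by
        rw [Real.dist_eq, abs_lt]
        constructor <;> linarith [hu.1, hu.2]
      have := hηf hd
      rwa [Real.dist_eq] at this
    have hfi : IntervalIntegrable f volume (rnode m k) (rnode m (k + 1)) := by
      refine (hf.mono ?_).intervalIntegrable
      rw [uIcc_of_le hab.le]
      exact Icc_subset_Icc hk0 hkt
    rcases lt_or_gt_of_ne hne with hneg | hpos
    · -- `f < 0` on the cell
      have hlt : ∀ u ∈ Ioo (rnode m k) (rnode m (k + 1)), 0 < -f u := fun u hu => by
        have h1 := hnear u (Ioo_subset_Icc_self hu)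
        rw [abs_of_neg hneg, abs_lt] at h1
        linarith [h1.1, h1.2]
      have hfi' : IntervalIntegrable (fun u => -f u) volume (rnode m k) (rnode m (k + 1)) := hfi.neg
      have hI := intervalIntegral.intervalIntegral_pos_of_pos_on hfi' hlt hab
      rw [intervalIntegral.integral_neg, h m k hkt, neg_zero] at hI
      exact lt_irrefl _ hI
    · -- `0 < f` on the cell
      have hlt : ∀ u ∈ Ioo (rnode m k) (rnode m (k + 1)), 0 < f u := fun u hu => by
        have h1 := hnear u (Ioo_subset_Icc_self hu)
        rw [abs_of_pos hpos, abs_lt] at h1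
        linarith [h1.1, h1.2]
      have hI := intervalIntegral.intervalIntegral_pos_of_pos_on hfi hlt hab
      rw [h m k hkt] at hI
      exact lt_irrefl _ hI
  -- and pass to the closure
  have hEq : EqOn f (fun _ => (0 : ℝ)) (Icc 0 t) :=
    (show EqOn f (fun _ => (0 : ℝ)) (Ioo 0 t) from hIoo).of_subset_closure hf continuousOn_const
      Ioo_subset_Icc_self (by rw [closure_Ioo ht.ne])
  exact hEq

/-- **Observability on `[0, t]`.** Let the coupling be non-degenerate (`V'' ≠ 0`) and let `c` be a
costate along a curve `ζ` on `[0, t]`, `t > 0` (continuous on `[0, t]`, `ċ = G(ζ)c` on `(0, t)`).  If the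
left-bath momentum component `β_0 = (c ·).2 0` has zero mean over every dyadic cell inside `[0, t]`, then
`c(t) = 0` (`β_0 ≡ 0` on `[0, t]` by §3; the tree's `costate_eq_zero_of_snd_left` on `J = (0, t)` gives
`c ≡ 0` there; continuity).  Tree `costate_one_eq_zero_of_dyadic` is `t = 1`.
[cite: CuneoEckmannHairerReyBellet2018, Prop 4.1] -/
theorem costate_at_eq_zero_of_dyadic (hVnd : ∀ r, deriv (deriv P.V) r ≠ 0) (hN : 0 < N) {t : ℝ}
    (ht : 0 < t) {ζ c : ℝ → PhaseSpace N} (hcc : ContinuousOn c (Icc 0 t))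
    (hc : ∀ s ∈ Ioo (0 : ℝ) t, HasDerivAt c (P.coDrift N (ζ s) (c s)) s)
    (h : ∀ m k : ℕ, rnode m (k + 1) ≤ t →
      ∫ s in rnode m k..rnode m (k + 1), (c s).2 ⟨0, hN⟩ = 0) :
    c t = 0 := by
  have hβc : ContinuousOn (fun s => (c s).2 ⟨0, hN⟩) (Icc 0 t) :=
    ((continuous_apply _).comp continuous_snd).comp_continuousOn hcc
  have hβ0 := eqOn_zero_of_dyadic_integral_eq_zero_of_le ht hβc h
  have hzero : ∀ s ∈ Ioo (0 : ℝ) t, c s = 0 :=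
    OscillatorChain.costate_eq_zero_of_snd_left hVnd hN isOpen_Ioo hc
      fun s hs => hβ0 s (Ioo_subset_Icc_self hs)
  have hEq : EqOn c (fun _ => (0 : PhaseSpace N)) (Icc 0 t) :=
    (show EqOn c (fun _ => (0 : PhaseSpace N)) (Ioo 0 t) from hzero).of_subset_closure hcc
      continuousOn_const Ioo_subset_Icc_self (by rw [closure_Ioo ht.ne])
  exact hEq (right_mem_Icc.2 ht.le)

end Summit.AtomisticToContinuum.FouriersLaw.Theorems.ExtensiveSnapshotIrreversibility.EnergyWindow

end
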